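import Literature.MathematicalPhysics.QuantumFieldTheory.Balaban1983to89.HaarAnalyticZeroSetNullLocalPiEngine

/-!
# `Balaban1983to89.HaarAnalyticZeroSetNullLocalPi` — THE OPEN-SET (LOCAL) EDITION FOR FINITELY MANY GROUP VARIABLES:
# for a compact group `G` faithfully represented on a log-charted linear group, EVERY Haar measure `μ`, every finite
# `ι` and `F` REAL-ANALYTIC ONLY ON AN OPEN `W ⊆ 𝔸^ι`, the zero set of `F` on `G^ι ∩ W` is `(⊗_ι μ)`-null up to its
# flat locus, and `(⊗_ι μ)`-null outright on every preconnected piece of `G^ι ∩ W` carrying one non-zero of `F`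

statement-level skeleton of published theorems with citation tags; proofs where landed; nothing here is a claim
about the Yang–Mills mass gap

Cell `pub-ymgap` (YM-PLAN Track A), node N09 [B12] width seat `pub-ymgap-dag-n09-w3` (g4), `--supports` K1⁷
`StabilityBAtRecordR13SepCoPH` = stmt-QuantumFields-20542 as a count-neutral helper.  File 3 of this seat's OPEN-SET
(local) edition (file 1 `HaarAnalyticZeroSetNullLocal`: one variable; file 2 `…LocalPiEngine`: the Fubini box engine;
file 4 `…LocalGroups`: instances at `U(N)`, `SU(N)`, closed `Gs ≤ U(N)`, `Setup.fieldMeasure`), and the LOCAL twin of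
dag-n09-w2's `HaarAnalyticZeroSetNullPi` (`F` real-analytic on ALL of `M_N(ℂ)^ι`, `Θ` onto; HONEST SCOPE (i) there:
«functionals analytic only near `G^ι` … are NOT covered»).  Here `F` need only be real-analytic on an OPEN `W ⊆ 𝔸^ι`;
the price is the identity theorem's: subtract the FLAT LOCUS `{g : F ∘ ρ^ι ≡ 0 near g}` (then NO surjectivity of `Θ`,
NO connectedness), or work on a preconnected piece of `G^ι ∩ W` with one non-zero.  LOCATED CONSUMER (pub-ymgap NODE
00 ∕ N09; dag-n09-w3 g3 `HANDOFF.md` §g3.3): functionals of the bond variables real-analytic only on the small-field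
domain (the (2.17) threshold of [Balaban1987RG1] on the local minimiser, the first-form thresholds on `∂U_k(V)`) under
`dU = Π_b dU(b)` — their analyticity there is N07's ∕ (F1)'s content and is NOT claimed here.

CITATION HEADER.  [BrockerTomDieck1985] Th. Bröcker, T. tom Dieck, *Representations of Compact Lie Groups*, GTM 98
(1985), Ch. IV Thm. (2.11) (proof), Ch. I (5.12)–(5.13).  [Mityagin2015] B. S. Mityagin, Math. Notes **107** (2020) ∕
arXiv:1512.07276, Prop. 1 (PROVED in the tree; the identity theorem used here is Mathlib's
`AnalyticOnNhd.eqOn_zero_of_preconnected_of_eventuallyEq_zero`).  [Helgason2000] Ch. I §1 Thm. 1.14 (13) p. 96 (p28's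
window formula, through files 1–2).

WHAT IS PROVED (theorems only; 0 definitions, 0 named facts, 0 sorry; axioms standard).  SETTING: files 1–2.
* §1 `continuous_translate_pi`, `exists_radius_translate_pi_subset` (`ρ∘g ∈ W` open ⇒ a chart box
  `Π_i ρ(g_i)·e^{B(0,s)} ⊆ W`, `0 < s ≤ s_C`), ★★★ `pi_traceZeroSet_diff_flat_eq_zero`:
  `(⊗_ι μ){g : ρ∘g ∈ W ∧ F(ρ∘g) = 0 ∧ ¬ ∀ᶠ g' in 𝓝 g, F(ρ∘g') = 0} = 0` — NO surjectivity of `Θ`, NO connectedness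
  (`measure_null_of_locally_null` over boxes, file 2's engine); `ae_pi_eventually_eq_zero_of_eq_zero`.
* §2 `analyticOnNhd_translate_pi_on`, ★ `eqOn_zero_box_of_flat` (one flat point in a box `Π_i g_i·V_s` whose chart box
  lies in `W` ⇒ `F ∘ ρ^ι ≡ 0` on the box: identity theorem on the sup-norm ball of `𝐠^ι`),
  `pi_flat_of_mem_closure_flat` (the flat locus is relatively closed in `G^ι ∩ W`),
  ★★★ `pi_zeroSet_eq_zero_of_isPreconnected_of_not_flat` ∕ ★★★ `pi_zeroSet_eq_zero_of_isPreconnected` (`S ⊆ G^ι`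
  preconnected, `ρ^ι(S) ⊆ W`, ONE non-flat point ∕ ONE `g₀ ∈ S` with `F(ρ∘g₀) ≠ 0` ⇒ `(⊗_ι μ){g ∈ S : F(ρ∘g) = 0} = 0`),
  `ae_pi_ne_zero_of_isPreconnected`.
* §3 conveniences — `isPreconnected_translate_window`, `isPreconnected_box` (continuous images of balls ∕ boxes of `𝐠`),
  ★★ `haar_zeroSet_inter_translate_window_eq_zero_of_exists` ∕ ★★ `pi_zeroSet_inter_box_eq_zero_of_exists` (`G`-level
  witnesses: one non-zero of `f ∘ ρ` IN a translated window ∕ box whose chart image lies in `W` ⇒ the zero set is null there).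

HONEST SCOPE.  (i) dag-n09-w2's global product theorems are NOT restated (the case `W = univ`, `S = univ`).  (ii) The
flat locus is genuinely needed on a disconnected trace.  (iii) Instances at the lineage's types are file 4.  (iv) Nothing
of the cited files or of Mathlib is re-proved.  (v) No claim about Bałaban's renormalization group: the fibre map of
(0.4), (F1), (F3) are untouched; `hreg`∕`contTOn` stay displayed; N09 is NOT discharged; nothing continuum ∕ OS ∕ mass
gap ∕ Clay.
-/

noncomputable section

open NormedSpace Set Function Filter Topology MeasureTheory
open scoped ENNReal NNReal

namespace Literature.MathematicalPhysics.QuantumFieldTheory.Balaban1983to89.HaarAnalyticZeroSetNullLocalPi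

open HaarExponentialChart HaarExponentialChart.IsChartRep
open HaarAnalyticZeroSetNullLocal HaarAnalyticZeroSetNullLocalPiEngine

section Generic

variable {𝔸 : Type*} [NormedRing 𝔸] [NormedAlgebra ℂ 𝔸] [CompleteSpace 𝔸]
variable {G : Type*} [Group G] [TopologicalSpace G] [IsTopologicalGroup G] [CompactSpace G]
variable {C : LogChart 𝔸} {ρ : G →* 𝔸} [FiniteDimensional ℝ C.lie]
variable [MeasurableSpace G] [BorelSpace G] (μ : Measure G) [μ.IsHaarMeasure]

/-! ## §1 The flat locus in `G^ι` -/

omit [CompactSpace G] [FiniteDimensional ℝ C.lie] [MeasurableSpace G] [BorelSpace G] in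
/-- The chart map of a box, `X ↦ (ρ(g_i)·e^{X_i})_i : 𝐠^ι → 𝔸^ι`, is continuous. [cite: Helgason2000, Ch. I §1 Thm. 1.14 (13) p. 96] -/
theorem continuous_translate_pi {ι : Type*} (a : ι → 𝔸) :
    Continuous (fun X : ι → C.lie => fun i => a i * exp (X i : 𝔸)) :=
  continuous_pi fun i => (continuous_translate (C := C) (a i)).comp (continuous_apply i)

omit [CompactSpace G] [FiniteDimensional ℝ C.lie] [MeasurableSpace G] [BorelSpace G] in
/-- For `ρ∘g ∈ W` open (finite `ι`) there is a chart radius `0 < s ≤ s_C` with `Π_i ρ(g_i)·e^{B(0,s)} ⊆ W`.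
[cite: Helgason2000, Ch. I §1 Thm. 1.14 (13) p. 96] -/
theorem exists_radius_translate_pi_subset {ι : Type*} [Fintype ι] {W : Set (ι → 𝔸)} (hW : IsOpen W) {a : ι → 𝔸}
    (ha : a ∈ W) : ∃ s : ℝ, 0 < s ∧ s ≤ chartRadius C ∧
      ∀ X : ι → C.lie, (∀ i, ‖X i‖ < s) → (fun i => a i * exp (X i : 𝔸)) ∈ W := by
  have h0 : (0 : ι → C.lie) ∈ (fun X : ι → C.lie => fun i => a i * exp (X i : 𝔸)) ⁻¹' W := by
    simp only [mem_preimage, Pi.zero_apply, Submodule.coe_zero, exp_zero, mul_one]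
    exact ha
  obtain ⟨r, hr, hball⟩ := Metric.isOpen_iff.1 (hW.preimage (continuous_translate_pi (C := C) a)) 0 h0
  refine ⟨min r (chartRadius C), lt_min hr chartRadius_pos, min_le_right _ _, fun X hX => hball ?_⟩
  rw [mem_ball_zero_iff, pi_norm_lt_iff hr]
  exact fun i => lt_of_lt_of_le (hX i) (min_le_left _ _)

/-- ★★★ **THE ZERO SET ON `G^ι ∩ W` IS NULL UP TO ITS FLAT LOCUS** — every compact chart-represented `G`, every Haar
`μ`, every finite `ι`, every open `W ⊆ 𝔸^ι` and every `F` real-analytic on `W` only: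
`(⊗_ι μ){g : ρ∘g ∈ W ∧ F(ρ∘g) = 0 ∧ ¬(F ∘ ρ^ι vanishes near g)} = 0`; NO surjectivity of `Θ`, NO connectedness (each
non-flat zero has a box of translated windows inside `W` on which the zero set is null, §2; `G^ι` is second countable).
[cite: BrockerTomDieck1985, IV (2.11) (proof), I (5.12)] [cite: Mityagin2015, Proposition 1]
[cite: Helgason2000, Ch. I §1 Thm. 1.14 (13) p. 96] -/
theorem pi_traceZeroSet_diff_flat_eq_zero (h : IsChartRep C ρ)
    (hlie : ∀ x ∈ C.lie, ∀ y ∈ C.lie, x * y - y * x ∈ C.lie) {ι : Type*} [Fintype ι] {W : Set (ι → 𝔸)}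
    (hW : IsOpen W) {F : (ι → 𝔸) → ℂ} (hF : AnalyticOnNhd ℝ F W) :
    Measure.pi (fun _ : ι => μ) {g : ι → G | (fun i => ρ (g i)) ∈ W ∧ F (fun i => ρ (g i)) = 0 ∧
      ¬ ∀ᶠ g' in 𝓝 g, F (fun i => ρ (g' i)) = 0} = 0 := by
  haveI := h.secondCountableTopology
  refine measure_null_of_locally_null _ fun g hg => ?_
  obtain ⟨hgW, -, hnf⟩ := hg
  obtain ⟨s, hs0, hs, hsub⟩ := exists_radius_translate_pi_subset (C := C) hW hgW
  set T : Set (ι → G) := {g' : ι → G | ∀ i, (g i)⁻¹ * g' i ∈ h.window s} with hT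
  have hTo : IsOpen T := isOpen_box h hs g
  have hgT : g ∈ T := fun i => by
    show (g i)⁻¹ * g i ∈ h.window s
    rw [inv_mul_cancel]; exact h.one_mem_window hs0
  have hTn : T ∈ 𝓝 g := hTo.mem_nhds hgT
  -- a non-vanishing chart point in the box (otherwise `g` would be flat)
  have hne : ∃ X₀ : ι → C.lie, (∀ i, ‖X₀ i‖ < s) ∧ F (fun i => ρ (g i) * exp (X₀ i : 𝔸)) ≠ 0 := by
    by_contra hcon
    push Not at hcon
    apply hnf
    filter_upwards [hTn] with g' hg'
    have hX : ∀ i, ∃ X : C.lie, X ∈ Metric.ball (0 : C.lie) s ∧ h.expChart X = (g i)⁻¹ * g' i := fun i => hg' i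
    choose X hXb hXe using hX
    have hρ : (fun i => ρ (g' i)) = fun i => ρ (g i) * exp (X i : 𝔸) := by
      funext i
      have h1 : g i * h.expChart (X i) = g' i := by rw [hXe i, mul_inv_cancel_left]
      rw [← h1, map_mul, h.rho_expChart]
    rw [hρ]
    exact hcon X fun i => mem_ball_zero_iff.1 (hXb i)
  refine ⟨T ∩ {g' : ι → G | (fun i => ρ (g' i)) ∈ W ∧ F (fun i => ρ (g' i)) = 0 ∧
      ¬ ∀ᶠ g'' in 𝓝 g', F (fun i => ρ (g'' i)) = 0},
    inter_mem (mem_nhdsWithin_of_mem_nhds hTn) self_mem_nhdsWithin, ?_⟩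
  refine measure_mono_null ?_ (pi_traceZeroSet_inter_box_eq_zero μ h hlie hs0 hs g hW hF hsub hne)
  intro g' hg'
  exact ⟨⟨hg'.2.1, hg'.2.2.1⟩, hg'.1⟩

/-- Almost-everywhere form of §3: `(⊗_ι μ)`-a.e. zero of `F ∘ ρ^ι` on `G^ι ∩ W` is a flat point.
[cite: BrockerTomDieck1985, IV (2.11) (proof)] [cite: Mityagin2015, Proposition 1] -/
theorem ae_pi_eventually_eq_zero_of_eq_zero (h : IsChartRep C ρ)
    (hlie : ∀ x ∈ C.lie, ∀ y ∈ C.lie, x * y - y * x ∈ C.lie) {ι : Type*} [Fintype ι] {W : Set (ι → 𝔸)}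
    (hW : IsOpen W) {F : (ι → 𝔸) → ℂ} (hF : AnalyticOnNhd ℝ F W) :
    ∀ᵐ g ∂(Measure.pi (fun _ : ι => μ)), (fun i => ρ (g i)) ∈ W → F (fun i => ρ (g i)) = 0 →
      ∀ᶠ g' in 𝓝 g, F (fun i => ρ (g' i)) = 0 := by
  rw [ae_iff]
  refine measure_mono_null (fun g hg => ?_) (pi_traceZeroSet_diff_flat_eq_zero μ h hlie hW hF)
  simp only [mem_setOf_eq, Classical.not_imp] at hg
  exact ⟨hg.1, hg.2.1, hg.2.2⟩

/-! ## §2 The identity theorem along `G^ι` and the preconnected form -/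

omit [CompactSpace G] [FiniteDimensional ℝ C.lie] [MeasurableSpace G] [BorelSpace G] in
/-- The box chart function `X ↦ F(ρ(g_i) e^{X_i})_i` is real-analytic on `{X : (ρ(g_i)e^{X_i})_i ∈ W}`.
[cite: Mityagin2015, Proposition 1] -/
theorem analyticOnNhd_translate_pi_on {ι : Type*} [Fintype ι] {W : Set (ι → 𝔸)} {F : (ι → 𝔸) → ℂ}
    (hF : AnalyticOnNhd ℝ F W) (a : ι → 𝔸) :
    AnalyticOnNhd ℝ (fun X : ι → C.lie => F (fun i => a i * exp (X i : 𝔸)))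
      {X : ι → C.lie | (fun i => a i * exp (X i : 𝔸)) ∈ W} := by
  intro X hX
  have h1 : ∀ i, AnalyticAt ℝ (fun Y : ι → C.lie => a i * exp ((Y i : C.lie) : 𝔸)) X := by
    intro i
    have hp : AnalyticAt ℝ (fun Y : ι → C.lie => Y i) X := (analyticAt_pi_iff.1 analyticAt_id) i
    have hsub' : AnalyticAt ℝ (fun Z : C.lie => (Z : 𝔸)) (X i) := (C.lie.subtypeL).analyticAt (X i)
    have hproj : AnalyticAt ℝ (fun Y : ι → C.lie => ((Y i : C.lie) : 𝔸)) X :=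
      AnalyticAt.comp (f := fun Y : ι → C.lie => Y i) (x := X) hsub' hp
    have h2 : AnalyticAt ℝ (fun b : 𝔸 => a i * exp b) ((X i : C.lie) : 𝔸) :=
      analyticAt_const.mul (NormedSpace.exp_analytic ((X i : C.lie) : 𝔸))
    exact AnalyticAt.comp (f := fun Y : ι → C.lie => ((Y i : C.lie) : 𝔸)) (x := X) h2 hproj
  have h3 : AnalyticAt ℝ (fun Y : ι → C.lie => fun i => a i * exp ((Y i : C.lie) : 𝔸)) X := AnalyticAt.pi h1
  refine (hF _ ?_).comp h3
  exact hX

omit [FiniteDimensional ℝ C.lie] [MeasurableSpace G] [BorelSpace G] in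
/-- ★ **ONE FLAT POINT FLATTENS THE BOX**: if `Π_i ρ(g_i)·e^{B(0,s)} ⊆ W` and `F ∘ ρ^ι` vanishes near ONE point of the
box `Π_i g_i·V_s`, it vanishes on the whole box (identity theorem on the preconnected sup-norm ball of `𝐠^ι`).
[cite: Mityagin2015, Proposition 1] [cite: BrockerTomDieck1985, IV (2.11) (proof)] -/
theorem eqOn_zero_box_of_flat (h : IsChartRep C ρ) {ι : Type*} [Fintype ι] {W : Set (ι → 𝔸)}
    {F : (ι → 𝔸) → ℂ} (hF : AnalyticOnNhd ℝ F W) {s : ℝ} (hs0 : 0 < s) (g : ι → G)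
    (hsub : ∀ X : ι → C.lie, (∀ i, ‖X i‖ < s) → (fun i => ρ (g i) * exp (X i : 𝔸)) ∈ W)
    {g₁ : ι → G} (hg₁ : ∀ i, (g i)⁻¹ * g₁ i ∈ h.window s)
    (hflat : ∀ᶠ g' in 𝓝 g₁, F (fun i => ρ (g' i)) = 0) :
    ∀ g' : ι → G, (∀ i, (g i)⁻¹ * g' i ∈ h.window s) → F (fun i => ρ (g' i)) = 0 := by
  set Φ : (ι → C.lie) → ℂ := fun X => F (fun i => ρ (g i) * exp (X i : 𝔸)) with hΦ
  have hball : ∀ X : ι → C.lie, X ∈ Metric.ball (0 : ι → C.lie) s ↔ ∀ i, ‖X i‖ < s := fun X => by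
    rw [mem_ball_zero_iff, pi_norm_lt_iff hs0]
  have hΦa : AnalyticOnNhd ℝ Φ (Metric.ball (0 : ι → C.lie) s) :=
    (analyticOnNhd_translate_pi_on (C := C) hF _).mono fun X hX => hsub X ((hball X).1 hX)
  -- the chart point of `g₁`
  have hX : ∀ i, ∃ X : C.lie, X ∈ Metric.ball (0 : C.lie) s ∧ h.expChart X = (g i)⁻¹ * g₁ i := fun i => hg₁ i
  choose X₁ hX₁b hX₁e using hX
  have hX₁ : X₁ ∈ Metric.ball (0 : ι → C.lie) s := (hball X₁).2 fun i => mem_ball_zero_iff.1 (hX₁b i)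
  have hcont : Continuous fun X : ι → C.lie => fun i => g i * h.expChart (X i) :=
    continuous_pi fun i => continuous_const.mul (h.continuous_expChart.comp (continuous_apply i))
  have hgX₁ : (fun i => g i * h.expChart (X₁ i)) = g₁ := funext fun i => by rw [hX₁e i, mul_inv_cancel_left]
  have hΦX₁ : Φ =ᶠ[𝓝 X₁] 0 := by
    have ht : Tendsto (fun X : ι → C.lie => fun i => g i * h.expChart (X i)) (𝓝 X₁) (𝓝 g₁) := by
      rw [← hgX₁]; exact hcont.continuousAt
    filter_upwards [ht.eventually hflat] with X hXf
    have : (fun i => ρ (g i * h.expChart (X i))) = fun i => ρ (g i) * exp (X i : 𝔸) :=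
      funext fun i => by rw [map_mul, h.rho_expChart]
    show F (fun i => ρ (g i) * exp (X i : 𝔸)) = 0
    rw [← this]; exact hXf
  have hΦ0 : EqOn Φ 0 (Metric.ball (0 : ι → C.lie) s) :=
    hΦa.eqOn_zero_of_preconnected_of_eventuallyEq_zero (convex_ball (0 : ι → C.lie) s).isPreconnected hX₁ hΦX₁
  intro g' hg'
  have hX' : ∀ i, ∃ X : C.lie, X ∈ Metric.ball (0 : C.lie) s ∧ h.expChart X = (g i)⁻¹ * g' i := fun i => hg' i
  choose X hXb hXe using hX'
  have hρ : (fun i => ρ (g' i)) = fun i => ρ (g i) * exp (X i : 𝔸) := by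
    funext i
    have h1 : g i * h.expChart (X i) = g' i := by rw [hXe i, mul_inv_cancel_left]
    rw [← h1, map_mul, h.rho_expChart]
  rw [hρ]
  exact hΦ0 ((hball X).2 fun i => mem_ball_zero_iff.1 (hXb i))

omit [FiniteDimensional ℝ C.lie] [MeasurableSpace G] [BorelSpace G] in
/-- **THE FLAT LOCUS IS RELATIVELY CLOSED IN `G^ι ∩ W`**. [cite: Mityagin2015, Proposition 1]
[cite: BrockerTomDieck1985, IV (2.11) (proof)] -/
theorem pi_flat_of_mem_closure_flat (h : IsChartRep C ρ) {ι : Type*} [Fintype ι] {W : Set (ι → 𝔸)} (hW : IsOpen W)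
    {F : (ι → 𝔸) → ℂ} (hF : AnalyticOnNhd ℝ F W) {g : ι → G} (hgW : (fun i => ρ (g i)) ∈ W)
    (hg : g ∈ closure {g' : ι → G | ∀ᶠ g'' in 𝓝 g', F (fun i => ρ (g'' i)) = 0}) :
    ∀ᶠ g' in 𝓝 g, F (fun i => ρ (g' i)) = 0 := by
  obtain ⟨s, hs0, hs, hsub⟩ := exists_radius_translate_pi_subset (C := C) hW hgW
  set T : Set (ι → G) := {g' : ι → G | ∀ i, (g i)⁻¹ * g' i ∈ h.window s} with hT
  have hTo : IsOpen T := isOpen_box h hs g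
  have hgT : g ∈ T := fun i => by
    show (g i)⁻¹ * g i ∈ h.window s
    rw [inv_mul_cancel]; exact h.one_mem_window hs0
  obtain ⟨g₁, hg₁T, hg₁flat⟩ := mem_closure_iff_nhds.1 hg T (hTo.mem_nhds hgT)
  have hall := eqOn_zero_box_of_flat h hF hs0 g hsub hg₁T hg₁flat
  exact Filter.mem_of_superset (hTo.mem_nhds hgT) fun g' hg' => hall g' hg'

/-- ★★★ **PRECONNECTED FORM, NON-FLAT WITNESS** in `G^ι`: `S ⊆ G^ι` preconnected, `ρ^ι(S) ⊆ W`, one point of `S`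
where `F ∘ ρ^ι` does not vanish identically nearby ⇒ `(⊗_ι μ){g ∈ S : F(ρ∘g) = 0} = 0`.
[cite: BrockerTomDieck1985, IV (2.11) (proof), I (5.12)] [cite: Mityagin2015, Proposition 1]
[cite: Helgason2000, Ch. I §1 Thm. 1.14 (13) p. 96] -/
theorem pi_zeroSet_eq_zero_of_isPreconnected_of_not_flat (h : IsChartRep C ρ)
    (hlie : ∀ x ∈ C.lie, ∀ y ∈ C.lie, x * y - y * x ∈ C.lie) {ι : Type*} [Fintype ι] {W : Set (ι → 𝔸)}
    (hW : IsOpen W) {F : (ι → 𝔸) → ℂ} (hF : AnalyticOnNhd ℝ F W) {S : Set (ι → G)} (hS : IsPreconnected S)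
    (hSW : ∀ g ∈ S, (fun i => ρ (g i)) ∈ W) (hne : ∃ g₀ ∈ S, ¬ ∀ᶠ g' in 𝓝 g₀, F (fun i => ρ (g' i)) = 0) :
    Measure.pi (fun _ : ι => μ) {g ∈ S | F (fun i => ρ (g i)) = 0} = 0 := by
  set Fl : Set (ι → G) := {g' : ι → G | ∀ᶠ g'' in 𝓝 g', F (fun i => ρ (g'' i)) = 0} with hFl
  have hFlo : IsOpen Fl := isOpen_setOf_eventually_nhds
  have hSFl : ∀ g ∈ S, g ∉ Fl := by
    intro g hgS hgFl
    have hsub : S ⊆ Fl := hS.subset_of_closure_inter_subset hFlo ⟨g, hgS, hgFl⟩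
      fun g' hg' => pi_flat_of_mem_closure_flat h hW hF (hSW g' hg'.2) hg'.1
    obtain ⟨g₀, hg₀S, hg₀⟩ := hne
    exact hg₀ (hsub hg₀S)
  refine measure_mono_null (fun g hg => ?_) (pi_traceZeroSet_diff_flat_eq_zero μ h hlie hW hF)
  exact ⟨hSW g hg.1, hg.2, hSFl g hg.1⟩

/-- ★★★ **PRECONNECTED FORM** in `G^ι`: `S ⊆ G^ι` preconnected, `ρ^ι(S) ⊆ W`, `F(ρ∘g₀) ≠ 0` for ONE `g₀ ∈ S` ⇒
`(⊗_ι μ){g ∈ S : F(ρ∘g) = 0} = 0` (dag-n09-w2's `pi_haar_zeroSet_eq_zero` is the case `W = univ`, `S = univ`).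
[cite: BrockerTomDieck1985, IV (2.11) (proof), I (5.12)] [cite: Mityagin2015, Proposition 1]
[cite: Helgason2000, Ch. I §1 Thm. 1.14 (13) p. 96] -/
theorem pi_zeroSet_eq_zero_of_isPreconnected (h : IsChartRep C ρ)
    (hlie : ∀ x ∈ C.lie, ∀ y ∈ C.lie, x * y - y * x ∈ C.lie) {ι : Type*} [Fintype ι] {W : Set (ι → 𝔸)}
    (hW : IsOpen W) {F : (ι → 𝔸) → ℂ} (hF : AnalyticOnNhd ℝ F W) {S : Set (ι → G)} (hS : IsPreconnected S)
    (hSW : ∀ g ∈ S, (fun i => ρ (g i)) ∈ W) (hne : ∃ g₀ ∈ S, F (fun i => ρ (g₀ i)) ≠ 0) :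
    Measure.pi (fun _ : ι => μ) {g ∈ S | F (fun i => ρ (g i)) = 0} = 0 := by
  obtain ⟨g₀, hg₀S, hg₀⟩ := hne
  exact pi_zeroSet_eq_zero_of_isPreconnected_of_not_flat μ h hlie hW hF hS hSW
    ⟨g₀, hg₀S, fun hflat => hg₀ hflat.self_of_nhds⟩

/-- Almost-everywhere form of the preconnected theorem in `G^ι`. [cite: BrockerTomDieck1985, IV (2.11) (proof)]
[cite: Mityagin2015, Proposition 1] -/
theorem ae_pi_ne_zero_of_isPreconnected (h : IsChartRep C ρ)
    (hlie : ∀ x ∈ C.lie, ∀ y ∈ C.lie, x * y - y * x ∈ C.lie) {ι : Type*} [Fintype ι] {W : Set (ι → 𝔸)}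
    (hW : IsOpen W) {F : (ι → 𝔸) → ℂ} (hF : AnalyticOnNhd ℝ F W) {S : Set (ι → G)} (hS : IsPreconnected S)
    (hSW : ∀ g ∈ S, (fun i => ρ (g i)) ∈ W) (hne : ∃ g₀ ∈ S, F (fun i => ρ (g₀ i)) ≠ 0) :
    ∀ᵐ g ∂(Measure.pi (fun _ : ι => μ)), g ∈ S → F (fun i => ρ (g i)) ≠ 0 := by
  rw [ae_iff]
  refine measure_mono_null (fun g hg => ?_) (pi_zeroSet_eq_zero_of_isPreconnected μ h hlie hW hF hS hSW hne)
  simp only [mem_setOf_eq, Classical.not_imp, not_not] at hg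
  exact hg

/-! ## §3 Conveniences for consumers: translated windows and boxes are preconnected; `G`-level witnesses -/

omit [FiniteDimensional ℝ C.lie] [MeasurableSpace G] [BorelSpace G] in
/-- A translated window `k·V_s = {g : k⁻¹g ∈ V_s}` is the continuous image of the ball `B(0,s) ⊆ 𝐠`, hence
preconnected. [cite: Helgason2000, Ch. I §1 Thm. 1.14 (13) p. 96] -/
theorem isPreconnected_translate_window (h : IsChartRep C ρ) (k : G) (s : ℝ) :
    IsPreconnected {g : G | k⁻¹ * g ∈ h.window s} := by
  have hset : {g : G | k⁻¹ * g ∈ h.window s} = (fun X : C.lie => k * h.expChart X) '' Metric.ball 0 s := by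
    ext g
    constructor
    · intro hg
      have hg' : k⁻¹ * g ∈ h.expChart '' Metric.ball 0 s := hg
      obtain ⟨X, hX, hXe⟩ := hg'
      exact ⟨X, hX, by show k * h.expChart X = g; rw [hXe, mul_inv_cancel_left]⟩
    · rintro ⟨X, hX, rfl⟩
      show k⁻¹ * (k * h.expChart X) ∈ h.window s
      rw [inv_mul_cancel_left]
      exact h.expChart_mem_window hX
  rw [hset]
  exact (convex_ball (0 : C.lie) s).isPreconnected.image _
    (continuous_const.mul h.continuous_expChart).continuousOn

omit [FiniteDimensional ℝ C.lie] [MeasurableSpace G] [BorelSpace G] in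
/-- A box of translated windows `Π_i k_i·V_s` is the continuous image of the box `Π_i B(0,s) ⊆ 𝐠^ι`, hence preconnected.
[cite: Helgason2000, Ch. I §1 Thm. 1.14 (13) p. 96] -/
theorem isPreconnected_box (h : IsChartRep C ρ) {ι : Type*} [Fintype ι] (k : ι → G) (s : ℝ) :
    IsPreconnected {g : ι → G | ∀ i, (k i)⁻¹ * g i ∈ h.window s} := by
  have hset : {g : ι → G | ∀ i, (k i)⁻¹ * g i ∈ h.window s} =
      (fun X : ι → C.lie => fun i => k i * h.expChart (X i)) '' Set.pi Set.univ (fun _ => Metric.ball (0 : C.lie) s) := by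
    ext g
    constructor
    · intro hg
      have hX : ∀ i, ∃ X : C.lie, X ∈ Metric.ball (0 : C.lie) s ∧ h.expChart X = (k i)⁻¹ * g i := fun i => hg i
      choose X hXb hXe using hX
      exact ⟨X, fun i _ => hXb i, funext fun i => by show k i * h.expChart (X i) = g i; rw [hXe i, mul_inv_cancel_left]⟩
    · rintro ⟨X, hX, rfl⟩ i
      show (k i)⁻¹ * (k i * h.expChart (X i)) ∈ h.window s
      rw [inv_mul_cancel_left]
      exact h.expChart_mem_window (hX i (Set.mem_univ i))
  rw [hset]
  refine (convex_pi fun i _ => convex_ball (0 : C.lie) s).isPreconnected.image _ ?_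
  exact (continuous_pi fun i => continuous_const.mul (h.continuous_expChart.comp (continuous_apply i))).continuousOn

/-- ★★ **ONE GROUP VARIABLE, `G`-LEVEL WITNESS**: if `ρ(k)·e^{B(0,s)} ⊆ W` and `f(ρ g₁) ≠ 0` for ONE `g₁` of the translated
window `k·V_s`, then `μ({g : f(ρ g) = 0} ∩ k·V_s) = 0` (the window is preconnected; file 1's preconnected theorem).
[cite: BrockerTomDieck1985, IV (2.11) (proof)] [cite: Mityagin2015, Proposition 1] [cite: Helgason2000, Ch. I §1 Thm. 1.14 (13) p. 96] -/
theorem haar_zeroSet_inter_translate_window_eq_zero_of_exists (h : IsChartRep C ρ)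
    (hlie : ∀ x ∈ C.lie, ∀ y ∈ C.lie, x * y - y * x ∈ C.lie) {W : Set 𝔸} (hW : IsOpen W) {f : 𝔸 → ℂ}
    (hf : AnalyticOnNhd ℝ f W) {s : ℝ} (k : G) (hsub : ∀ X : C.lie, ‖X‖ < s → ρ k * exp (X : 𝔸) ∈ W)
    (hne : ∃ g₁ : G, k⁻¹ * g₁ ∈ h.window s ∧ f (ρ g₁) ≠ 0) :
    μ {g ∈ {g : G | k⁻¹ * g ∈ h.window s} | f (ρ g) = 0} = 0 := by
  refine haar_zeroSet_eq_zero_of_isPreconnected μ h hlie hW hf (isPreconnected_translate_window h k s) ?_ hne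
  intro g hg
  have hg' : k⁻¹ * g ∈ h.expChart '' Metric.ball 0 s := hg
  obtain ⟨X, hX, hXe⟩ := hg'
  have h1 : k * h.expChart X = g := by rw [hXe, mul_inv_cancel_left]
  rw [← h1, map_mul, h.rho_expChart]
  exact hsub X (mem_ball_zero_iff.1 hX)

/-- ★★ **SEVERAL GROUP VARIABLES, `G^ι`-LEVEL WITNESS**: if `Π_i ρ(k_i)·e^{B(0,s)} ⊆ W` and `F(ρ∘g₁) ≠ 0` for ONE `g₁`
of the box `Π_i k_i·V_s`, then `(⊗_ι μ)({g : F(ρ∘g) = 0} ∩ Π_i k_i·V_s) = 0` (the box is preconnected).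
[cite: BrockerTomDieck1985, IV (2.11) (proof), I (5.12)] [cite: Mityagin2015, Proposition 1]
[cite: Helgason2000, Ch. I §1 Thm. 1.14 (13) p. 96] -/
theorem pi_zeroSet_inter_box_eq_zero_of_exists (h : IsChartRep C ρ)
    (hlie : ∀ x ∈ C.lie, ∀ y ∈ C.lie, x * y - y * x ∈ C.lie) {ι : Type*} [Fintype ι] {W : Set (ι → 𝔸)}
    (hW : IsOpen W) {F : (ι → 𝔸) → ℂ} (hF : AnalyticOnNhd ℝ F W) {s : ℝ} (k : ι → G)
    (hsub : ∀ X : ι → C.lie, (∀ i, ‖X i‖ < s) → (fun i => ρ (k i) * exp (X i : 𝔸)) ∈ W)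
    (hne : ∃ g₁ : ι → G, (∀ i, (k i)⁻¹ * g₁ i ∈ h.window s) ∧ F (fun i => ρ (g₁ i)) ≠ 0) :
    Measure.pi (fun _ : ι => μ) {g ∈ {g : ι → G | ∀ i, (k i)⁻¹ * g i ∈ h.window s} | F (fun i => ρ (g i)) = 0} = 0 := by
  refine pi_zeroSet_eq_zero_of_isPreconnected μ h hlie hW hF (isPreconnected_box h k s) ?_ hne
  intro g hg
  have hX : ∀ i, ∃ X : C.lie, X ∈ Metric.ball (0 : C.lie) s ∧ h.expChart X = (k i)⁻¹ * g i := fun i => hg i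
  choose X hXb hXe using hX
  have hρ : (fun i => ρ (g i)) = fun i => ρ (k i) * exp (X i : 𝔸) := by
    funext i
    have h1 : k i * h.expChart (X i) = g i := by rw [hXe i, mul_inv_cancel_left]
    rw [← h1, map_mul, h.rho_expChart]
  rw [hρ]
  exact hsub X fun i => mem_ball_zero_iff.1 (hXb i)

end Generic

end Literature.MathematicalPhysics.QuantumFieldTheory.Balaban1983to89.HaarAnalyticZeroSetNullLocalPi

end
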